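import Summits.QuantumAdvantage.QuantumAdvantage.Theorems.CubicForrelationNearExactIsExactTwelvePartnerRadical
import Summits.QuantumAdvantage.QuantumAdvantage.Theorems.CubicForrelationNearExactIsExactCubicFormR4PartnerLevelTables
import Summits.QuantumAdvantage.QuantumAdvantage.Theorems.CubicForrelationNearExactIsExactCubicFormR4QfPolar
import Summits.QuantumAdvantage.QuantumAdvantage.Theorems.CubicForrelationNearExactIsExactCubicFormR4ZQuad
import Summits.QuantumAdvantage.QuantumAdvantage.Theorems.CubicForrelationNearExactIsExactCubicFormR4TRadical

/-!
# Crux `CubicForrelation.NearExactIsExact` (stmt-QuantumAdvantage-14043) — E1280-even, R4 branch, descendant `0` (`HZ`): the cells are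
  quadratic, the radical step, and the PIGEONHOLE on the radical (the dimension lemma (★) of R4-PARTNER §3 in Lean)

Certificate seat `b2b-cforr-cert` (gen 43).  HONEST FRAMING: kernel-checked tools (standard axioms) for the descendant `t̄₇ = 0` of
…CubicFormR4PartnerDispatch.  In the adapted R4 frame with `d` vanishing on `z × z × z`:
* `tq0_third_expand` / `tq0_cells_quadratic`: third differences of `κ` along `z`-block vectors expand trilinearly in `d|_{z×z×z} = 0`, so
  every cell `f_p = κ(p, ·)` (`p ∈ 𝔽₂⁵`) has vanishing third differences.
* `tq0_radical_step`: the radical step of …CubicFormR4TRadical for `t̄₇ = 0` (no support condition on `û`): if the second differences of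
  all cells along `(û, e_k)` vanish at `0` and `f_v(û) = f_v(0)` on `Z₁₀`, then `False`.
* `tq0_pigeon` (**(★) as a pigeonhole**): if `S ⊆ 𝔽₂⁷` is a set of vectors `u` with `Δ_{u,e_k} f_v(0) = 0` for all cells and
  `#S > 2^{n₆₄}`, `n₆₄ = #{v ∈ Z₁₀ : #f_v = 64}`, then `False`: two elements of `S` induce the same flips on the `64`-cells (cells of other
  weights never flip along such `u`: a flipping constant derivative forces weight `64`), and their sum is a radical vector.
* `tq0_sum_Z10`: the ten-term weight sum of …CubicFormR4Cells as a `Finset` sum over `Z₁₀`.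
Nothing about `θ₁₂`; NOT summit progress.

References: this seat lineage (g37 R4-PARTNER §3 (★), g43 LEAN-GEN43).  Axioms: the standard three.
-/

set_option linter.dupNamespace false -- D-0017: single-problem summit ⇒ `QuantumAdvantage.QuantumAdvantage` by design

namespace Summit.QuantumAdvantage.QuantumAdvantage.Theorems.CubicForrelation.NearExactIsExact

open Finset
open Literature.Computability.QuantumComplexity
open Literature.Computability.QuantumComplexity.BuzetChailloux (bxor zeroVec bxor_comm bxor_self bxor_zeroVec zeroVec_bxor
  bxor_bxor_cancel_left)

/-- **The ten-cell sum over `Z₁₀` as a `Finset` sum.** [folklore] -/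
theorem tq0_sum_Z10 (w : (Fin 4 → Bool) → ℕ) :
    (∑ v ∈ univ.filter (fun v : Fin 4 → Bool => ((v 0 && v 1) ^^ (v 2 && v 3)) = false), w v) =
      w ![false, false, false, false] + w ![false, false, false, true] + w ![false, false, true, false] + w ![false, true, false, false] + w ![false, true, false, true] + w ![false, true, true, false] + w ![true, false, false, false] + w ![true, false, false, true] + w ![true, false, true, false] + w ![true, true, true, true] := by
  have hsum : ∀ F : (Fin 4 → Bool) → ℕ, ∑ v : Fin 4 → Bool, F v = ∑ b₀ : Bool, ∑ b₁ : Bool, ∑ b₂ : Bool, ∑ b₃ : Bool, F ![b₀, b₁, b₂, b₃] := by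
    intro F
    let e : (Fin 4 → Bool) ≃ Bool × Bool × Bool × Bool :=
      ⟨fun c => (c 0, c 1, c 2, c 3), fun t => ![t.1, t.2.1, t.2.2.1, t.2.2.2], fun c => by funext i; fin_cases i <;> rfl, fun t => rfl⟩
    rw [Fintype.sum_equiv e F (fun t => F ![t.1, t.2.1, t.2.2.1, t.2.2.2]) (fun c => by
      show F c = F ![c 0, c 1, c 2, c 3]; congr 1; funext i; fin_cases i <;> rfl)]
    simp only [Fintype.sum_prod_type]
  rw [sum_filter, hsum]
  have hq : ∀ b₀ b₁ b₂ b₃ : Bool, (((![b₀, b₁, b₂, b₃] : Fin 4 → Bool) 0 && (![b₀, b₁, b₂, b₃] : Fin 4 → Bool) 1) ^^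
      ((![b₀, b₁, b₂, b₃] : Fin 4 → Bool) 2 && (![b₀, b₁, b₂, b₃] : Fin 4 → Bool) 3)) = ((b₀ && b₁) ^^ (b₂ && b₃)) := by
    intro b₀ b₁ b₂ b₃; rfl
  simp only [hq, Fintype.sum_bool]
  simp
  omega

/-- **Trilinear expansion of third differences along `z`-block vectors.**  For cubic `κ` with cubic form `d` vanishing on `z × z × z`:
the third difference of `κ` along three vectors supported on the `z`-block vanishes. [this work] -/
theorem tq0_third_expand (κ : (Fin (5 + 7) → Bool) → Bool) (hκ : IsDegLeFun 3 κ) (d : Fin (5 + 7) → Fin (5 + 7) → Fin (5 + 7) → ZMod 2)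
    (hd : ∀ φ j k, d φ j k =
      if ((((κ zeroVec ^^ κ (bxor zeroVec (fun l => decide (l = k)))) ^^ (κ (bxor zeroVec (fun l => decide (l = j))) ^^ κ (bxor (bxor zeroVec (fun l => decide (l = j))) (fun l => decide (l = k))))) ^^
          ((κ (bxor zeroVec (fun l => decide (l = φ))) ^^ κ (bxor (bxor zeroVec (fun l => decide (l = φ))) (fun l => decide (l = k)))) ^^ (κ (bxor (bxor zeroVec (fun l => decide (l = φ))) (fun l => decide (l = j))) ^^ κ (bxor (bxor (bxor zeroVec (fun l => decide (l = φ))) (fun l => decide (l = j))) (fun l => decide (l = k))))))) = true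
      then 1 else 0)
    (hzzz : ∀ σ τ υ : Fin 7, d (Fin.natAdd 5 σ) (Fin.natAdd 5 τ) (Fin.natAdd 5 υ) = 0) (u v w : Fin 7 → Bool) (x : Fin (5 + 7) → Bool) :
    ((((κ x ^^ κ (bxor x (Fin.append (zeroVec : Fin 5 → Bool) w))) ^^ (κ (bxor x (Fin.append (zeroVec : Fin 5 → Bool) v)) ^^ κ (bxor (bxor x (Fin.append (zeroVec : Fin 5 → Bool) v)) (Fin.append (zeroVec : Fin 5 → Bool) w)))) ^^
        ((κ (bxor x (Fin.append (zeroVec : Fin 5 → Bool) u)) ^^ κ (bxor (bxor x (Fin.append (zeroVec : Fin 5 → Bool) u)) (Fin.append (zeroVec : Fin 5 → Bool) w))) ^^ (κ (bxor (bxor x (Fin.append (zeroVec : Fin 5 → Bool) u)) (Fin.append (zeroVec : Fin 5 → Bool) v)) ^^ κ (bxor (bxor (bxor x (Fin.append (zeroVec : Fin 5 → Bool) u)) (Fin.append (zeroVec : Fin 5 → Bool) v)) (Fin.append (zeroVec : Fin 5 → Bool) w)))))) = false := by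
  -- coefficient vectors and the `decide` form of the embedded vectors
  have hemb : ∀ s : Fin 7 → Bool, Fin.append (zeroVec : Fin 5 → Bool) s =
      fun i => decide ((Fin.append (fun _ : Fin 5 => (0 : ZMod 2)) (fun σ => if s σ = true then (1 : ZMod 2) else 0) i) = 1) := by
    intro s; funext i
    refine Fin.addCases (fun a => ?_) (fun σ => ?_) i
    · simp only [Fin.append_left]; show false = _; simp
    · simp only [Fin.append_right]; cases s σ <;> simp
  -- expansion in the first slot, for `z`-supported coefficient vectors
  have hexp : ∀ (s : Fin 7 → Bool) (V' W' x' : Fin (5 + 7) → Bool),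
      (if ((((κ x' ^^ κ (bxor x' W')) ^^ (κ (bxor x' V') ^^ κ (bxor (bxor x' V') W'))) ^^
          ((κ (bxor x' (Fin.append (zeroVec : Fin 5 → Bool) s)) ^^ κ (bxor (bxor x' (Fin.append (zeroVec : Fin 5 → Bool) s)) W')) ^^ (κ (bxor (bxor x' (Fin.append (zeroVec : Fin 5 → Bool) s)) V') ^^ κ (bxor (bxor (bxor x' (Fin.append (zeroVec : Fin 5 → Bool) s)) V') W'))))) = true then (1 : ZMod 2) else 0) =
      ∑ σ : Fin 7, (if s σ = true then (1 : ZMod 2) else 0) *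
        (if ((((κ x' ^^ κ (bxor x' W')) ^^ (κ (bxor x' V') ^^ κ (bxor (bxor x' V') W'))) ^^
            ((κ (bxor x' (fun l => decide (l = Fin.natAdd 5 σ))) ^^ κ (bxor (bxor x' (fun l => decide (l = Fin.natAdd 5 σ))) W')) ^^ (κ (bxor (bxor x' (fun l => decide (l = Fin.natAdd 5 σ))) V') ^^ κ (bxor (bxor (bxor x' (fun l => decide (l = Fin.natAdd 5 σ))) V') W'))))) = true then (1 : ZMod 2) else 0) := by
    intro s V' W' x'
    rw [hemb s, tcf_third_sum1 κ hκ _ V' W' x', Fin.sum_univ_add]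
    simp only [Fin.append_left, zero_mul, sum_const_zero, zero_add, Fin.append_right]
  -- the value as an element of `𝔽₂`
  have key : ∀ b : Bool, (if b = true then (1 : ZMod 2) else 0) = 0 → b = false := by
    intro b hb; cases b
    · rfl
    · simp at hb
  apply key
  rw [hexp]
  refine sum_eq_zero fun σ _ => ?_
  rw [tcf_third_swap12 κ (fun l => decide (l = Fin.natAdd 5 σ)) _ _ x, hexp]
  rw [mul_eq_zero]; right
  refine sum_eq_zero fun τ _ => ?_
  rw [tcf_third_swap23 κ (fun l => decide (l = Fin.natAdd 5 τ)) _ _ x, tcf_third_swap12 κ (fun l => decide (l = Fin.natAdd 5 τ)) _ _ x, hexp]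
  rw [mul_eq_zero]; right
  refine sum_eq_zero fun υ _ => ?_
  rw [tcf_third_const κ hκ _ _ _ x zeroVec, ← hd, hzzz υ τ σ, mul_zero]

/-- **Every cell is quadratic** when `d` vanishes on `z × z × z`: the third differences of `f_p = κ(p, ·)` vanish. [this work] -/
theorem tq0_cells_quadratic (κ : (Fin (5 + 7) → Bool) → Bool) (hκ : IsDegLeFun 3 κ) (d : Fin (5 + 7) → Fin (5 + 7) → Fin (5 + 7) → ZMod 2)
    (hd : ∀ φ j k, d φ j k =
      if ((((κ zeroVec ^^ κ (bxor zeroVec (fun l => decide (l = k)))) ^^ (κ (bxor zeroVec (fun l => decide (l = j))) ^^ κ (bxor (bxor zeroVec (fun l => decide (l = j))) (fun l => decide (l = k))))) ^^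
          ((κ (bxor zeroVec (fun l => decide (l = φ))) ^^ κ (bxor (bxor zeroVec (fun l => decide (l = φ))) (fun l => decide (l = k)))) ^^ (κ (bxor (bxor zeroVec (fun l => decide (l = φ))) (fun l => decide (l = j))) ^^ κ (bxor (bxor (bxor zeroVec (fun l => decide (l = φ))) (fun l => decide (l = j))) (fun l => decide (l = k))))))) = true
      then 1 else 0)
    (hzzz : ∀ σ τ υ : Fin 7, d (Fin.natAdd 5 σ) (Fin.natAdd 5 τ) (Fin.natAdd 5 υ) = 0) (p : Fin 5 → Bool) (u v w x : Fin 7 → Bool) :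
    ((((κ (Fin.append p x) ^^ κ (Fin.append p (bxor x w))) ^^ (κ (Fin.append p (bxor x v)) ^^ κ (Fin.append p (bxor (bxor x v) w)))) ^^
        ((κ (Fin.append p (bxor x u)) ^^ κ (Fin.append p (bxor (bxor x u) w))) ^^ (κ (Fin.append p (bxor (bxor x u) v)) ^^ κ (Fin.append p (bxor (bxor (bxor x u) v) w)))))) = false := by
  rw [tc5_third_rho κ p u v w x]
  exact tq0_third_expand κ hκ d hd hzzz u v w (Fin.append p x)

/-- **The radical step for `t̄₇ = 0` (function level).**  `κ` cubic with cubic form `d` (`hd`) vanishing on `z × z × z`, partner `c`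
(`hpair`), `hF`; `û ∈ 𝔽₂⁷` nonzero; the second differences of every cell along `(û, e_k)` vanish at `0`; `f_v(û) = f_v(0)` on `Z₁₀`.
Then `False` (as …CubicFormR4TRadical's `tq1_radical_step`, without the support condition). [this work] -/
theorem tq0_radical_step (κ : (Fin (5 + 7) → Bool) → Bool) (hκ : IsDegLeFun 3 κ)
    (c d : Fin (5 + 7) → Fin (5 + 7) → Fin (5 + 7) → ZMod 2)
    (hdc : ∀ φ j k, d j φ k = d φ j k) (hds : ∀ φ j k, d φ k j = d φ j k)
    (hd : ∀ φ j k, d φ j k =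
      if ((((κ zeroVec ^^ κ (bxor zeroVec (fun l => decide (l = k)))) ^^
              (κ (bxor zeroVec (fun l => decide (l = j))) ^^ κ (bxor (bxor zeroVec (fun l => decide (l = j))) (fun l => decide (l = k))))) ^^
            ((κ (bxor zeroVec (fun l => decide (l = φ))) ^^ κ (bxor (bxor zeroVec (fun l => decide (l = φ))) (fun l => decide (l = k)))) ^^
              (κ (bxor (bxor zeroVec (fun l => decide (l = φ))) (fun l => decide (l = j))) ^^
                κ (bxor (bxor (bxor zeroVec (fun l => decide (l = φ))) (fun l => decide (l = j))) (fun l => decide (l = k))))))) = true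
      then 1 else 0)
    (hpair : ∀ p φ, (∑ j, ∑ k, (if j < k then c p j k * d φ j k else 0)) = if p = φ then 1 else 0)
    (hF : ∀ j k, d (Fin.castAdd 7 (0 : Fin 5)) j k =
      (if (j = Fin.castAdd 7 (1 : Fin 5) ∧ k = Fin.castAdd 7 (2 : Fin 5)) ∨ (j = Fin.castAdd 7 (2 : Fin 5) ∧ k = Fin.castAdd 7 (1 : Fin 5)) then 1 else 0) +
      (if (j = Fin.castAdd 7 (3 : Fin 5) ∧ k = Fin.castAdd 7 (4 : Fin 5)) ∨ (j = Fin.castAdd 7 (4 : Fin 5) ∧ k = Fin.castAdd 7 (3 : Fin 5)) then 1 else 0))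
    (hzzz : ∀ σ τ υ : Fin 7, d (Fin.natAdd 5 σ) (Fin.natAdd 5 τ) (Fin.natAdd 5 υ) = 0)
    (û : Fin 7 → Bool) (hune : û ≠ zeroVec)
    (h1 : ∀ (v : Fin 4 → Bool) (k : Fin 7),
      ((κ (Fin.append (Matrix.vecCons false v) zeroVec) ^^ κ (Fin.append (Matrix.vecCons false v) (fun l => decide (l = k)))) ^^
        (κ (Fin.append (Matrix.vecCons false v) û) ^^ κ (Fin.append (Matrix.vecCons false v) (bxor û (fun l => decide (l = k)))))) = false)
    (h2 : ∀ v : Fin 4 → Bool, ((v 0 && v 1) ^^ (v 2 && v 3)) = false →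
      κ (Fin.append (Matrix.vecCons false v) û) = κ (Fin.append (Matrix.vecCons false v) zeroVec)) : False := by
  -- the coefficient vector of `û` and the embedded vector `ũ = (0, 0, û)`
  let uz : Fin 7 → ZMod 2 := fun σ => if û σ = true then 1 else 0
  have huz : uz ≠ 0 := by
    intro h0
    apply hune
    funext σ
    have e := congrFun h0 σ
    simp only [uz, Pi.zero_apply] at e
    cases hσ : û σ
    · rfl
    · rw [hσ] at e; exact absurd e (by simp)
  let Uc : Fin (5 + 7) → ZMod 2 := Fin.append (fun _ : Fin 5 => (0 : ZMod 2)) uz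
  let ut : Fin (5 + 7) → Bool := fun i => decide (Uc i = 1)
  have hut : Fin.append (zeroVec : Fin 5 → Bool) û = ut := by
    funext i
    refine Fin.addCases (fun a => ?_) (fun σ => ?_) i
    · simp only [ut, Uc, Fin.append_left]
      show false = _
      simp
    · simp only [ut, Uc, uz, Fin.append_right]
      cases û σ <;> simp
  -- expansion of third differences along `ut` in the first slot
  have hsum3 : ∀ v w x : Fin (5 + 7) → Bool,
      (if ((((κ x ^^ κ (bxor x w)) ^^ (κ (bxor x v) ^^ κ (bxor (bxor x v) w))) ^^
          ((κ (bxor x ut) ^^ κ (bxor (bxor x ut) w)) ^^ (κ (bxor (bxor x ut) v) ^^ κ (bxor (bxor (bxor x ut) v) w))))) = true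
        then (1 : ZMod 2) else 0) =
      ∑ σ : Fin 7, uz σ * (if ((((κ x ^^ κ (bxor x w)) ^^ (κ (bxor x v) ^^ κ (bxor (bxor x v) w))) ^^
          ((κ (bxor x (fun l => decide (l = Fin.natAdd 5 σ))) ^^ κ (bxor (bxor x (fun l => decide (l = Fin.natAdd 5 σ))) w)) ^^
            (κ (bxor (bxor x (fun l => decide (l = Fin.natAdd 5 σ))) v) ^^ κ (bxor (bxor (bxor x (fun l => decide (l = Fin.natAdd 5 σ))) v) w))))) = true
        then (1 : ZMod 2) else 0) := by
    intro v w x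
    have e := tcf_third_sum1 κ hκ Uc v w x
    rw [e, Fin.sum_univ_add]
    simp only [Uc, Fin.append_left, zero_mul, sum_const_zero, zero_add, Fin.append_right]
  -- cells as translates: `κ(0,v,s) = κ(X_v ⊕ (0,0,s))`, `X` additive, `X_0 = 0`, `X_{e_t} = e_{1+t}`
  have hcell : ∀ (v : Fin 4 → Bool) (s : Fin 7 → Bool), κ (Fin.append (Matrix.vecCons false v) s) =
      κ (bxor (Fin.append (Matrix.vecCons false v) zeroVec) (Fin.append (zeroVec : Fin 5 → Bool) s)) := by
    intro v s; rw [tc5_append_bxor, bxor_zeroVec, zeroVec_bxor]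
  have hsplit : ∀ s s' : Fin 7 → Bool, Fin.append (zeroVec : Fin 5 → Bool) (bxor s s') =
      bxor (Fin.append (zeroVec : Fin 5 → Bool) s) (Fin.append (zeroVec : Fin 5 → Bool) s') := by
    intro s s'; rw [tc5_append_bxor, bxor_zeroVec]
  have hXb : ∀ x t : Fin 4 → Bool, (Fin.append (Matrix.vecCons false (bxor x t)) (zeroVec : Fin 7 → Bool) : Fin (5 + 7) → Bool) =
      bxor (Fin.append (Matrix.vecCons false x) zeroVec) (Fin.append (Matrix.vecCons false t) zeroVec) := by
    intro x t
    rw [tc5_append_bxor, bxor_zeroVec]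
    congr 1
    funext l
    refine Fin.cases ?_ (fun i => ?_) l
    · rfl
    · rfl
  have hX0 : (Fin.append (Matrix.vecCons false (zeroVec : Fin 4 → Bool)) (zeroVec : Fin 7 → Bool) : Fin (5 + 7) → Bool) = zeroVec := by
    funext l
    refine Fin.addCases (fun i => ?_) (fun j => ?_) l
    · rw [Fin.append_left]
      refine Fin.cases rfl (fun i' => rfl) i
    · rw [Fin.append_right]; rfl
  have hXe : ∀ t : Fin 4, (Fin.append (Matrix.vecCons false (fun l => decide (l = t))) (zeroVec : Fin 7 → Bool) : Fin (5 + 7) → Bool) =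
      fun l => decide (l = Fin.castAdd 7 t.succ) := by
    intro t
    rw [tc5_unit_left]
    congr 1
    funext l
    refine Fin.cases ?_ (fun i => ?_) l
    · exact (decide_eq_false (fun h => Fin.succ_ne_zero t h.symm)).symm
    · show decide (i = t) = decide (i.succ = t.succ)
      by_cases h : i = t
      · subst h; simp
      · rw [decide_eq_false h, decide_eq_false (fun h' => h (Fin.succ_inj.mp h'))]
  -- the hypotheses in `κ`-form
  have h1' : ∀ (v : Fin 4 → Bool) (k : Fin 7),
      ((κ (Fin.append (Matrix.vecCons false v) zeroVec) ^^ κ (bxor (Fin.append (Matrix.vecCons false v) zeroVec) (fun l => decide (l = Fin.natAdd 5 k)))) ^^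
        (κ (bxor (Fin.append (Matrix.vecCons false v) zeroVec) ut) ^^
          κ (bxor (bxor (Fin.append (Matrix.vecCons false v) zeroVec) ut) (fun l => decide (l = Fin.natAdd 5 k))))) = false := by
    intro v k
    have e := h1 v k
    rw [hcell v (fun l => decide (l = k)), hcell v û, hcell v (bxor û _), hsplit, ← tc5_unit_right, hut, ← iw_bxor_assoc] at e
    exact e
  have h2' : ∀ v : Fin 4 → Bool, ((v 0 && v 1) ^^ (v 2 && v 3)) = false →
      κ (bxor (Fin.append (Matrix.vecCons false v) zeroVec) ut) = κ (Fin.append (Matrix.vecCons false v) zeroVec) := by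
    intro v hv
    have e := h2 v hv
    rw [hcell v û, hut] at e
    exact e
  -- (1) `Σ u_σ d(z_σ, z_j, z_k) = 0`
  have hzz' : ∀ j k : Fin 7, (∑ σ, uz σ * d (Fin.natAdd 5 σ) (Fin.natAdd 5 j) (Fin.natAdd 5 k)) = 0 := by
    intro j k
    refine sum_eq_zero fun σ _ => ?_
    rw [hzzz, mul_zero]
  -- (2) `Σ u_σ d(z_σ, v_t, z_k) = 0`: the third difference along `(e_{v_t}, ut, e_{z_k})` is `Δ_{ut,z_k}(0) ⊕ Δ_{ut,z_k}(e_{v_t}) = 0 ⊕ 0`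
  have hvz' : ∀ (t : Fin 4) (k : Fin 7), (∑ σ, uz σ * d (Fin.natAdd 5 σ) (Fin.castAdd 7 t.succ) (Fin.natAdd 5 k)) = 0 := by
    intro t k
    have hT : ((((κ zeroVec ^^ κ (bxor zeroVec (fun l => decide (l = Fin.natAdd 5 k)))) ^^ (κ (bxor zeroVec ut) ^^ κ (bxor (bxor zeroVec ut) (fun l => decide (l = Fin.natAdd 5 k))))) ^^
        ((κ (bxor zeroVec (fun l => decide (l = Fin.castAdd 7 t.succ))) ^^ κ (bxor (bxor zeroVec (fun l => decide (l = Fin.castAdd 7 t.succ))) (fun l => decide (l = Fin.natAdd 5 k)))) ^^ (κ (bxor (bxor zeroVec (fun l => decide (l = Fin.castAdd 7 t.succ))) ut) ^^ κ (bxor (bxor (bxor zeroVec (fun l => decide (l = Fin.castAdd 7 t.succ))) ut) (fun l => decide (l = Fin.natAdd 5 k))))))) = false := by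
      have a := h1' zeroVec k
      have b := h1' (fun l => decide (l = t)) k
      rw [hX0] at a
      rw [hXe] at b
      simp only [zeroVec_bxor] at a b ⊢
      rw [a, b]
      decide
    conv_lhs => arg 2; ext σ; rw [hd]
    rw [← hsum3 (fun l => decide (l = Fin.castAdd 7 t.succ)) (fun l => decide (l = Fin.natAdd 5 k)) zeroVec,
      tcf_third_swap12 κ ut (fun l => decide (l = Fin.castAdd 7 t.succ)) (fun l => decide (l = Fin.natAdd 5 k)) zeroVec, hT]
    simp
  -- (3) the first difference `q(v) = f_v(û) ⊕ f_v(0)`: vanishes on `Z₁₀`, constant second differences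
  have hB : ∀ s t x : Fin 4 → Bool,
      (((κ (Fin.append (Matrix.vecCons false x) zeroVec) ^^ κ (bxor (Fin.append (Matrix.vecCons false x) zeroVec) ut)) ^^
          ((κ (Fin.append (Matrix.vecCons false (bxor x t)) zeroVec) ^^ κ (bxor (Fin.append (Matrix.vecCons false (bxor x t)) zeroVec) ut)))) ^^
        (((κ (Fin.append (Matrix.vecCons false (bxor x s)) zeroVec) ^^ κ (bxor (Fin.append (Matrix.vecCons false (bxor x s)) zeroVec) ut))) ^^
          ((κ (Fin.append (Matrix.vecCons false (bxor (bxor x s) t)) zeroVec) ^^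
            κ (bxor (Fin.append (Matrix.vecCons false (bxor (bxor x s) t)) zeroVec) ut))))) =
      (((κ zeroVec ^^ κ (bxor zeroVec ut)) ^^
          (κ (bxor zeroVec (Fin.append (Matrix.vecCons false t) zeroVec)) ^^ κ (bxor (bxor zeroVec (Fin.append (Matrix.vecCons false t) zeroVec)) ut))) ^^
        ((κ (bxor zeroVec (Fin.append (Matrix.vecCons false s) zeroVec)) ^^ κ (bxor (bxor zeroVec (Fin.append (Matrix.vecCons false s) zeroVec)) ut)) ^^
          (κ (bxor (bxor zeroVec (Fin.append (Matrix.vecCons false s) zeroVec)) (Fin.append (Matrix.vecCons false t) zeroVec)) ^^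
            κ (bxor (bxor (bxor zeroVec (Fin.append (Matrix.vecCons false s) zeroVec)) (Fin.append (Matrix.vecCons false t) zeroVec)) ut)))) := by
    intro s t x
    simp only [hXb]
    exact tcf_third_const κ hκ _ _ _ _ _
  have hz : ∀ v : Fin 4 → Bool, ((v 0 && v 1) ^^ (v 2 && v 3)) = false →
      (κ (Fin.append (Matrix.vecCons false v) zeroVec) ^^ κ (bxor (Fin.append (Matrix.vecCons false v) zeroVec) ut)) = false := by
    intro v hv
    rw [h2' v hv]
    exact Bool.xor_self _
  have P := tq4_polar_table (fun v => κ (Fin.append (Matrix.vecCons false v) zeroVec) ^^ κ (bxor (Fin.append (Matrix.vecCons false v) zeroVec) ut))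
    (fun s t => (((κ zeroVec ^^ κ (bxor zeroVec ut)) ^^
          (κ (bxor zeroVec (Fin.append (Matrix.vecCons false t) zeroVec)) ^^ κ (bxor (bxor zeroVec (Fin.append (Matrix.vecCons false t) zeroVec)) ut))) ^^
        ((κ (bxor zeroVec (Fin.append (Matrix.vecCons false s) zeroVec)) ^^ κ (bxor (bxor zeroVec (Fin.append (Matrix.vecCons false s) zeroVec)) ut)) ^^
          (κ (bxor (bxor zeroVec (Fin.append (Matrix.vecCons false s) zeroVec)) (Fin.append (Matrix.vecCons false t) zeroVec)) ^^
            κ (bxor (bxor (bxor zeroVec (Fin.append (Matrix.vecCons false s) zeroVec)) (Fin.append (Matrix.vecCons false t) zeroVec)) ut)))))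
    hB hz
  -- the table `[B(e_a, e_c)] = Σ u_σ d(z_σ, v_a, v_c)`
  have hBac : ∀ a b : Fin 4,
      (if ((((κ zeroVec ^^ κ (bxor zeroVec ut)) ^^ (κ (bxor zeroVec (Fin.append (Matrix.vecCons false (fun l => decide (l = b))) zeroVec)) ^^ κ (bxor (bxor zeroVec (Fin.append (Matrix.vecCons false (fun l => decide (l = b))) zeroVec)) ut))) ^^
        ((κ (bxor zeroVec (Fin.append (Matrix.vecCons false (fun l => decide (l = a))) zeroVec)) ^^ κ (bxor (bxor zeroVec (Fin.append (Matrix.vecCons false (fun l => decide (l = a))) zeroVec)) ut)) ^^ (κ (bxor (bxor zeroVec (Fin.append (Matrix.vecCons false (fun l => decide (l = a))) zeroVec)) (Fin.append (Matrix.vecCons false (fun l => decide (l = b))) zeroVec)) ^^ κ (bxor (bxor (bxor zeroVec (Fin.append (Matrix.vecCons false (fun l => decide (l = a))) zeroVec)) (Fin.append (Matrix.vecCons false (fun l => decide (l = b))) zeroVec)) ut))))) = true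
        then (1 : ZMod 2) else 0) =
      ∑ σ, uz σ * d (Fin.natAdd 5 σ) (Fin.castAdd 7 a.succ) (Fin.castAdd 7 b.succ) := by
    intro a b
    rw [hXe, hXe, tcf_third_swap23 κ (fun l => decide (l = Fin.castAdd 7 a.succ)) (fun l => decide (l = Fin.castAdd 7 b.succ)) ut zeroVec,
      tcf_third_swap12 κ (fun l => decide (l = Fin.castAdd 7 a.succ)) ut (fun l => decide (l = Fin.castAdd 7 b.succ)) zeroVec,
      hsum3 (fun l => decide (l = Fin.castAdd 7 a.succ)) (fun l => decide (l = Fin.castAdd 7 b.succ)) zeroVec]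
    refine sum_congr rfl fun σ _ => ?_
    rw [hd]
  -- `d(y_a, v_a, v_c)` from `hF`
  have hFab : ∀ a b : Fin 4, d (Fin.castAdd 7 (0 : Fin 5)) (Fin.castAdd 7 a.succ) (Fin.castAdd 7 b.succ) =
      (if (a = 0 ∧ b = 1) ∨ (a = 1 ∧ b = 0) then (1 : ZMod 2) else 0) + (if (a = 2 ∧ b = 3) ∨ (a = 3 ∧ b = 2) then (1 : ZMod 2) else 0) := by
    intro a b
    rw [hF, show (1 : Fin 5) = Fin.succ (0 : Fin 4) from rfl, show (2 : Fin 5) = Fin.succ (1 : Fin 4) from rfl,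
      show (3 : Fin 5) = Fin.succ (2 : Fin 4) from rfl, show (4 : Fin 5) = Fin.succ (3 : Fin 4) from rfl]
    simp only [Fin.castAdd_inj, Fin.succ_inj]
  -- conclude with the form-level lemma
  refine tq1_radical c d hdc hds hpair hF uz (∑ σ, uz σ * d (Fin.natAdd 5 σ) (Fin.castAdd 7 (0 : Fin 4).succ) (Fin.castAdd 7 (1 : Fin 4).succ))
    huz hzz' hvz' (fun a b => ?_)
  have e := P a b
  rw [hBac, hBac, ← hFab] at e
  exact e


/-- **(★) as a pigeonhole.**  `κ` cubic with cubic form `d` vanishing on `z × z × z`, partner, `hF`.  Let `S ⊆ 𝔽₂⁷` consist of vectors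
`u` along which the second differences `Δ_{u,e_k} f_v(0)` of all cells vanish.  If `#S > 2^{n₆₄}`, `n₆₄` the number of cells of `Z₁₀` of
weight exactly `64`, then `False`: cells of other weights do not flip along `S` (a flipping constant derivative forces `64` ones), two
elements of `S` flip the same `64`-cells, and their sum is a radical vector (`tq0_radical_step`). [this work] -/
theorem tq0_pigeon (κ : (Fin (5 + 7) → Bool) → Bool) (hκ : IsDegLeFun 3 κ)
    (c d : Fin (5 + 7) → Fin (5 + 7) → Fin (5 + 7) → ZMod 2)
    (hdc : ∀ φ j k, d j φ k = d φ j k) (hds : ∀ φ j k, d φ k j = d φ j k)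
    (hd : ∀ φ j k, d φ j k =
      if ((((κ zeroVec ^^ κ (bxor zeroVec (fun l => decide (l = k)))) ^^ (κ (bxor zeroVec (fun l => decide (l = j))) ^^ κ (bxor (bxor zeroVec (fun l => decide (l = j))) (fun l => decide (l = k))))) ^^
          ((κ (bxor zeroVec (fun l => decide (l = φ))) ^^ κ (bxor (bxor zeroVec (fun l => decide (l = φ))) (fun l => decide (l = k)))) ^^ (κ (bxor (bxor zeroVec (fun l => decide (l = φ))) (fun l => decide (l = j))) ^^ κ (bxor (bxor (bxor zeroVec (fun l => decide (l = φ))) (fun l => decide (l = j))) (fun l => decide (l = k))))))) = true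
      then 1 else 0)
    (hpair : ∀ p φ, (∑ j, ∑ k, (if j < k then c p j k * d φ j k else 0)) = if p = φ then 1 else 0)
    (hF : ∀ j k, d (Fin.castAdd 7 (0 : Fin 5)) j k =
      (if (j = Fin.castAdd 7 (1 : Fin 5) ∧ k = Fin.castAdd 7 (2 : Fin 5)) ∨ (j = Fin.castAdd 7 (2 : Fin 5) ∧ k = Fin.castAdd 7 (1 : Fin 5)) then 1 else 0) +
      (if (j = Fin.castAdd 7 (3 : Fin 5) ∧ k = Fin.castAdd 7 (4 : Fin 5)) ∨ (j = Fin.castAdd 7 (4 : Fin 5) ∧ k = Fin.castAdd 7 (3 : Fin 5)) then 1 else 0))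
    (hzzz : ∀ σ τ υ : Fin 7, d (Fin.natAdd 5 σ) (Fin.natAdd 5 τ) (Fin.natAdd 5 υ) = 0)
    (S : Finset (Fin 7 → Bool))
    (hS : ∀ u ∈ S, ∀ (v : Fin 4 → Bool) (k : Fin 7), ((κ (Fin.append (Matrix.vecCons false v) zeroVec) ^^ κ (Fin.append (Matrix.vecCons false v) (fun l => decide (l = k)))) ^^ (κ (Fin.append (Matrix.vecCons false v) u) ^^ κ (Fin.append (Matrix.vecCons false v) (bxor u (fun l => decide (l = k)))))) = false)
    (hcard : 2 ^ #((univ.filter fun v : Fin 4 → Bool => ((v 0 && v 1) ^^ (v 2 && v 3)) = false).filter fun v => #(univ.filter fun s : Fin 7 → Bool => κ (Fin.append (Matrix.vecCons false v) s) = true) = 64) < #S) : False := by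
  classical
  -- cells are quadratic
  have hq : ∀ (v : Fin 4 → Bool) (u' v' w x : Fin 7 → Bool),
      ((((κ (Fin.append (Matrix.vecCons false v) x) ^^ κ (Fin.append (Matrix.vecCons false v) (bxor x w))) ^^ (κ (Fin.append (Matrix.vecCons false v) (bxor x v')) ^^ κ (Fin.append (Matrix.vecCons false v) (bxor (bxor x v') w)))) ^^
          ((κ (Fin.append (Matrix.vecCons false v) (bxor x u')) ^^ κ (Fin.append (Matrix.vecCons false v) (bxor (bxor x u') w))) ^^ (κ (Fin.append (Matrix.vecCons false v) (bxor (bxor x u') v')) ^^ κ (Fin.append (Matrix.vecCons false v) (bxor (bxor (bxor x u') v') w)))))) = false :=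
    fun v u' v' w x => tq0_cells_quadratic κ hκ d hd hzzz (Matrix.vecCons false v) u' v' w x
  set T : Finset (Fin 4 → Bool) := (univ.filter fun v : Fin 4 → Bool => ((v 0 && v 1) ^^ (v 2 && v 3)) = false).filter fun v => #(univ.filter fun s : Fin 7 → Bool => κ (Fin.append (Matrix.vecCons false v) s) = true) = 64 with hT
  -- two elements of `S` with the same flips on the `64`-cells
  have hmaps : ∀ u ∈ S, (T.filter fun v => κ (Fin.append (Matrix.vecCons false v) u) ≠ κ (Fin.append (Matrix.vecCons false v) zeroVec)) ∈ T.powerset :=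
    fun u _ => mem_powerset.mpr (filter_subset _ _)
  have hlt : #(T.powerset) < #S := by rw [card_powerset]; exact hcard
  obtain ⟨u, hu, u', hu', hne, hφ⟩ := exists_ne_map_eq_of_card_lt_of_maps_to hlt hmaps
  -- cells of `Z₁₀` outside `T` do not flip along `S`
  have hnoflip : ∀ u ∈ S, ∀ v : Fin 4 → Bool, ((v 0 && v 1) ^^ (v 2 && v 3)) = false → v ∉ T → κ (Fin.append (Matrix.vecCons false v) u) = κ (Fin.append (Matrix.vecCons false v) zeroVec) := by
    intro u hu v hv hvT
    by_contra hne'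
    have hc := tq0_deriv_const (fun s : Fin 7 → Bool => κ (Fin.append (Matrix.vecCons false v) s)) (hq v) u (hS u hu v)
    have hflip : ∀ s : Fin 7 → Bool, κ (Fin.append (Matrix.vecCons false v) (bxor s u)) = !κ (Fin.append (Matrix.vecCons false v) s) := by
      intro s; rw [hc s]; revert hne'
      cases κ (Fin.append (Matrix.vecCons false v) zeroVec) <;> cases κ (Fin.append (Matrix.vecCons false v) u) <;> cases κ (Fin.append (Matrix.vecCons false v) s) <;> decide
    have h64 := tq1_flip_card (fun s : Fin 7 → Bool => κ (Fin.append (Matrix.vecCons false v) s)) u hflip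
    exact hvT (by rw [hT, mem_filter, mem_filter]; exact ⟨⟨mem_univ _, hv⟩, h64⟩)
  -- the rows of `u`, `u'` vanish
  have hrow : ∀ u ∈ S, ∀ (v : Fin 4 → Bool) (y : Fin 7 → Bool),
      ((κ (Fin.append (Matrix.vecCons false v) zeroVec) ^^ κ (Fin.append (Matrix.vecCons false v) y)) ^^ (κ (Fin.append (Matrix.vecCons false v) u) ^^ κ (Fin.append (Matrix.vecCons false v) (bxor u y)))) = false :=
    fun u hu v => tq0_form_row_zero (fun s : Fin 7 → Bool => κ (Fin.append (Matrix.vecCons false v) s)) (hq v) u (hS u hu v)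
  have hw0 : bxor u u' ≠ zeroVec := by
    intro h0; apply hne; funext i
    have e1 := congrFun h0 i
    simp only [bxor, zeroVec] at e1
    revert e1; cases u i <;> cases u' i <;> decide
  refine tq0_radical_step κ hκ c d hdc hds hd hpair hF hzzz (bxor u u') hw0 (fun v k => ?_) (fun v hv => ?_)
  · have a := hrow u hu v (fun l => decide (l = k))
    have b := hrow u' hu' v (bxor u (fun l => decide (l = k)))
    have c' := hrow u' hu' v u
    rw [show bxor (bxor u u') (fun l => decide (l = k)) = bxor u' (bxor u (fun l => decide (l = k))) from by
      rw [bxor_comm u u', iw_bxor_assoc], bxor_comm u u']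
    revert a b c'
    cases κ (Fin.append (Matrix.vecCons false v) zeroVec) <;> cases κ (Fin.append (Matrix.vecCons false v) (fun l => decide (l = k))) <;> cases κ (Fin.append (Matrix.vecCons false v) u) <;>
      cases κ (Fin.append (Matrix.vecCons false v) (bxor u (fun l => decide (l = k)))) <;> cases κ (Fin.append (Matrix.vecCons false v) u') <;>
      cases κ (Fin.append (Matrix.vecCons false v) (bxor u' (bxor u (fun l => decide (l = k))))) <;> cases κ (Fin.append (Matrix.vecCons false v) (bxor u' u)) <;> decide
  · have c' := hrow u' hu' v u
    rw [bxor_comm u u']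
    by_cases hvT : v ∈ T
    · have hm : v ∈ (T.filter fun v => κ (Fin.append (Matrix.vecCons false v) u) ≠ κ (Fin.append (Matrix.vecCons false v) zeroVec)) ↔
          v ∈ (T.filter fun v => κ (Fin.append (Matrix.vecCons false v) u') ≠ κ (Fin.append (Matrix.vecCons false v) zeroVec)) := by rw [hφ]
      simp only [mem_filter, hvT, true_and] at hm
      revert c' hm
      cases κ (Fin.append (Matrix.vecCons false v) zeroVec) <;> cases κ (Fin.append (Matrix.vecCons false v) u) <;> cases κ (Fin.append (Matrix.vecCons false v) u') <;> cases κ (Fin.append (Matrix.vecCons false v) (bxor u' u)) <;> decide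
    · have e1 := hnoflip u hu v hv hvT
      have e2 := hnoflip u' hu' v hv hvT
      revert c' e1 e2
      cases κ (Fin.append (Matrix.vecCons false v) zeroVec) <;> cases κ (Fin.append (Matrix.vecCons false v) u) <;> cases κ (Fin.append (Matrix.vecCons false v) u') <;> cases κ (Fin.append (Matrix.vecCons false v) (bxor u' u)) <;> decide

end Summit.QuantumAdvantage.QuantumAdvantage.Theorems.CubicForrelation.NearExactIsExact
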